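import Literature.AlgebraicGeometry.Modules.StrictlyPerfectResolution
import Summits.Ventures.HSemireg.HomComplexSigmaSingle
import Summits.Ventures.HSemireg.HomComplexSigmaQuasiIso
import HarnessLib

/-!
# `I`-semiregularity of an `𝒪_X`-module COMPUTED ON a strictly perfect resolution (Buchweitz–Flenner's semiregularity of a
# coherent / torsion sheaf, read in `D^b(X)`)

Cell b2b hodge-weil (Weil-type ladder; prover-b2b-hweil-pv1-g64-0, 2026-08-23, carver orders C859 (b) / C863 (d)); input for the definition
item `defn-SheafSemiregularityMap` (filed `--for stmt-HodgeConjecture-2524`). HONEST FRAMING: definitions and proved lemmas on real carriers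
only — NOT a door, NOT a named fact, NOT a rung, nothing about any variety, nothing conditional on HC_CM; it does NOT produce a resolution of
the cell's sheaf `𝒢` nor decide its semiregularity. Buchweitz–Flenner define `σ = (σ_q)_q : Ext²_X(F, F) → ∏_q H^{q+2}(X, Λ^q 𝕃)` for a
PERFECT COMPLEX `F` (Def. 4.1) and prove the variational Hodge conjecture for `I`-semiregular SHEAVES (Thm. 5.1). The venture
`Summits/Ventures/HSemireg` (cell `pub-hsemireg`, 2026-08-22) typed `σ_q` on real carriers for a strictly perfect MODEL `K•`:
`HomComplex.sigmaC / sigmaCoh / IsISemiregularC X K a b hK`, invariant under quasi-isomorphisms / roofs (`isISemiregularC_iff_of_quasiIso`,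
`…_of_roof`) and equal to the tree's module-level `IsISemiregular hE₀ I` on `E₀[0]` (`isISemiregularC_single₀_iff`). This file is the
SHEAF-LEVEL reading for a module `E₀` that is not a vector bundle (e.g. a torsion sheaf), computed on the honest datum
`Modules.StrictlyPerfectResolution E₀` (`ε : P• ⥲ E₀[0]`):

* `IsISemiregularSheafVia X R I := HomComplex.IsISemiregularC X R.P (-R.length) 0 …` (a DEFINITION; `(σ_q)_{q ∈ I}` of the resolving
  complex jointly injective on `Ext²(P•, P•) ≅ Ext²(E₀, E₀)`); `…_iff_of_window`; **`…_iff_of_hom` / `…_iff_of_roof`** (independence of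
  the resolution: a morphism of resolutions over `E₀` is a quasi-isomorphism, two-out-of-three); **`…_ofFiniteLocallyFree_iff`** /
  `…_iff_isISemiregular` (on a vector bundle it IS `IsISemiregular hE₀ I`, via HSemireg's column anchor);
  `IsISemiregularSheaf X E₀ I := ∃ R, …` (false, not vacuously true, without a resolution) with `isISemiregularSheaf_iff_isISemiregular`.
* the VALUE: `extTwoOnResolution X R : Ext²(E₀, E₀) → Ext²(P•, P•)` (conjugation by the isomorphism `Q ε`, bijective),
  **`sigmaSheafVia X R q : Ext²(E₀, E₀) → H^{q+2}(X, Ω^q)`** and the KERNEL FORM `isISemiregularSheafVia_iff_ker :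
  IsISemiregularSheafVia X R I ↔ ∀ x, (∀ q ∈ I, sigmaSheafVia X R q x = 0) → x = 0` — the literal shape of the tree's `IsISemiregular`.

IMPORT DISCIPLINE (C863 (d)(β)): only `HomComplexSigmaSingle` and `HomComplexSigmaQuasiIso` are imported from the venture (closure: 22 Summits
modules, no `Ring2*` / `HodgeCM*`). The door-free lemmas of `PerfectComplexSigmaQuasiIso.lean` §1 / `PerfectComplexSigmaDoor.lean` §0 used
here (window independence of `σ_q`; `σ_q(x) = 0` in `Hom_D` iff in `H^{q+2}`) are RE-DERIVED as `private` lemmas (verbatim proofs, attributed),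
because those files import `Ring2.Hypotheses`; delete the copies when the venture splits them out. PLACEMENT: the file imports
`Summits/Ventures/HSemireg`, so it cannot live under `Literature/`; it lives in the cell's `Theorems/WeilTypeLadder*` family because the gate
binds files under `Summits/Ventures/HSemireg/` to that venture's own items. Indexing as in the tree: `I` is a set of FORM degrees `q`
(`σ_q ∈ H^{q+2}(X, Ω^q)`; BF's index is `p = q + 1`); signs / factorials `(-1)^q/q!` of BF Def. 4.1 are not inserted (kernels unchanged).
NOT here: existence of resolutions; additivity of `sigmaSheafVia` and independence of its VALUE of `R` (only the kernel predicate's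
independence is proved); the sheaf-level BF Thm. 5.1 (a named fact, to be filed once placement is settled).

References: R.-O. Buchweitz, H. Flenner, *A semiregularity map for modules and applications to deformations*, Compositio Math. 137
(2003), Def. 4.1, §5 / Thm. 5.1 [BuchweitzFlenner2003]; L. Illusie, *Complexe cotangent et déformations I*, LNM 239 (1971), V.3–V.5
[Illusie1971]; R. Hartshorne, *Algebraic Geometry* (1977), III Prop. 6.3 (c) [Hartshorne1977].
-/

noncomputable section

open CategoryTheory CategoryTheory.Limits AlgebraicGeometry

namespace Summit.Ventures.HSemireg

open Literature.AlgebraicGeometry.Modules Literature.AlgebraicGeometry.Motives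
open Literature.AlgebraicGeometry.HodgeTheory

/-! ### Ring2-free private re-derivations (HSemireg `PerfectComplexSigmaQuasiIso` §1, `PerfectComplexSigmaDoor` §0) -/

namespace HomComplex

section WindowPrivate

universe w

variable (Y : Scheme.{w}) (E : CochainComplex Y.Modules ℤ)

/-- A unit summand vanishes when `E^{-i} = 0` (= HSemireg `unitSummand_eq_zero_of_isZero`, p340744, re-derived
to avoid its file's `Ring2` import). [folklore] -/
private theorem unitSummand_eq_zero_of_isZero' (i : ℤ) (h : IsZero (E.X (-i))) : unitSummand Y E i = 0 := by
  change sheafHomUnit (E.X (-i)) ≫ ι Y E E (-i) i 0 _ = 0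
  rw [(isZero_sheafHom_of_isZero h (E.X (-i))).eq_of_tgt (sheafHomUnit (E.X (-i))) 0, zero_comp]

/-- The degree-`0` unit over a larger window equals the one over `[a, b] ∋ supp E•` (= HSemireg
`unitDeg₀_eq_of_le`, re-derived). [folklore] -/
private theorem unitDeg₀_eq_of_le' (a b a' b' : ℤ) (ha : a' ≤ a) (hb : b ≤ b') [E.IsStrictlyGE a]
    [E.IsStrictlyLE b] : unitDeg₀ Y E a' b' = unitDeg₀ Y E a b := by
  unfold unitDeg₀
  symm
  refine Finset.sum_subset (Finset.Icc_subset_Icc (by lia) (by lia)) fun j hj hj' => ?_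
  simp only [Finset.mem_Icc, not_and_or, not_le] at hj hj'
  rcases hj' with hj' | hj'
  · exact unitSummand_eq_zero_of_isZero' Y E j (E.isZero_of_isStrictlyLE b _ (by lia))
  · exact unitSummand_eq_zero_of_isZero' Y E j (E.isZero_of_isStrictlyGE a _ (by lia))

/-- The unit over a larger window equals the one over `[a, b]` (= HSemireg `unit_eq_of_le`, re-derived). [folklore] -/
private theorem unit_eq_of_le' (a b a' b' : ℤ) (ha : a' ≤ a) (hb : b ≤ b') [E.IsStrictlyGE a] [E.IsStrictlyLE b]
    [E.IsStrictlyGE a'] [E.IsStrictlyLE b'] : unit Y E a' b' = unit Y E a b := by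
  refine HomologicalComplex.from_single_hom_ext ?_
  rw [unit, unit, HomologicalComplex.mkHomFromSingle_f, HomologicalComplex.mkHomFromSingle_f,
    unitDeg₀_eq_of_le' Y E a b a' b' ha hb]

/-- The unit does not depend on the window (= HSemireg `unit_eq_of_window`, re-derived). [folklore] -/
private theorem unit_eq_of_window' (a b a' b' : ℤ) [E.IsStrictlyGE a] [E.IsStrictlyLE b] [E.IsStrictlyGE a']
    [E.IsStrictlyLE b'] : unit Y E a' b' = unit Y E a b := by
  haveI := E.isStrictlyGE_of_ge (min a a') a (min_le_left _ _)
  haveI := E.isStrictlyLE_of_le b (max b b') (le_max_left _ _)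
  rw [← unit_eq_of_le' Y E a b (min a a') (max b b') (min_le_left _ _) (le_max_left _ _),
    unit_eq_of_le' Y E a' b' (min a a') (max b b') (min_le_right _ _) (le_max_right _ _)]

end WindowPrivate

section SigmaPrivate

universe w₁ u₁

variable {S : Type u₁} [CommRing S] (X : Over (Spec (CommRingCat.of S))) [HasDerivedCategory.{w₁} X.left.Modules]
  (K : CochainComplex X.left.Modules ℤ) (a b a' b' : ℤ)
  [K.IsStrictlyGE a] [K.IsStrictlyLE b] [K.IsStrictlyGE a'] [K.IsStrictlyLE b']
  (hK : ∀ p, IsFiniteLocallyFree (K.X p))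

/-- `σ_q` does not depend on the window (= HSemireg `sigmaC_eq_of_window`, re-derived).
[cite: BuchweitzFlenner2003, Def. 4.1] -/
private theorem sigmaC_eq_of_window' (q : ℕ)
    (x : ShiftedHom (DerivedCategory.Q.obj K) (DerivedCategory.Q.obj K) (2 : ℤ)) :
    sigmaC X K a' b' hK q x = sigmaC X K a b hK q x := by
  rw [sigmaC, sigmaC, unitQ, unitQ, unit_eq_of_window' X.left K a b a' b']
  rfl

/-- `I`-semiregularity does not depend on the window (= HSemireg `isISemiregularC_iff_of_window`, re-derived).
[cite: BuchweitzFlenner2003, §5 (I-semiregular)] -/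
private theorem isISemiregularC_iff_of_window' (I : Set ℕ) :
    IsISemiregularC X K a' b' hK I ↔ IsISemiregularC X K a b hK I := by
  have h : (fun (x : ShiftedHom (DerivedCategory.Q.obj K) (DerivedCategory.Q.obj K) (2 : ℤ)) (q : I) =>
      sigmaC X K a' b' hK q x) =
      fun (x : ShiftedHom (DerivedCategory.Q.obj K) (DerivedCategory.Q.obj K) (2 : ℤ)) (q : I) =>
        sigmaC X K a b hK q x := by
    funext x; funext q
    exact sigmaC_eq_of_window' X K a b a' b' hK q x
  rw [IsISemiregularC, IsISemiregularC, h]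

omit [K.IsStrictlyGE a'] [K.IsStrictlyLE b'] in
/-- `σ_q(x) = 0` in `Hom_D` iff `σ_q(x) = 0 ∈ H^{q+2}(X, Ω^q)` (`Ext.homEquiv`, `extToCohomology_bijective`) (= HSemireg
`sigmaCoh_eq_zero_of_sigmaC_eq_zero` / converse, p333889, re-derived). [cite: Hartshorne1977, III Prop. 6.3 (c)] -/
private theorem sigmaCoh_eq_zero_iff' (q : ℕ)
    (x : ShiftedHom (DerivedCategory.Q.obj K) (DerivedCategory.Q.obj K) (2 : ℤ)) :
    sigmaCoh X K a b hK q x = 0 ↔ sigmaC X K a b hK q x = 0 := by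
  rw [sigmaCoh]
  constructor
  · intro h0
    have h1 : sigmaExt X K a b hK q x = 0 :=
      (extToCohomology_bijective (hodgeSheaf X q) (q + 2)).1
        (h0.trans (map_zero (extToCohomology (hodgeSheaf X q) (q + 2))).symm)
    rw [sigmaExt, Equiv.symm_apply_eq] at h1
    exact h1.trans (Abelian.Ext.zero_hom _ _ _)
  · intro h0
    have h1 : sigmaExt X K a b hK q x = 0 := by
      rw [sigmaExt, Equiv.symm_apply_eq, h0]
      exact (Abelian.Ext.zero_hom _ _ _).symm
    rw [h1, map_zero]
    rfl

omit [K.IsStrictlyGE a'] [K.IsStrictlyLE b'] in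
/-- `I`-semiregularity iff the COHOMOLOGICAL joint-kernel condition (= HSemireg `isISemiregularC_iff_coh`, p333889,
re-derived from `isISemiregularC_iff_ker`). [cite: BuchweitzFlenner2003, §5 (I-semiregular)] -/
private theorem isISemiregularC_iff_coh' (I : Set ℕ) :
    IsISemiregularC X K a b hK I ↔
      ∀ x : ShiftedHom (DerivedCategory.Q.obj K) (DerivedCategory.Q.obj K) (2 : ℤ),
        (∀ q ∈ I, sigmaCoh X K a b hK q x = 0) → x = 0 := by
  rw [isISemiregularC_iff_ker]
  exact ⟨fun h x hx => h x fun q hq => (sigmaCoh_eq_zero_iff' X K a b hK q x).1 (hx q hq),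
    fun h x hx => h x fun q hq => (sigmaCoh_eq_zero_iff' X K a b hK q x).2 (hx q hq)⟩

end SigmaPrivate

end HomComplex

end Summit.Ventures.HSemireg

/-! ### The sheaf-level predicate -/

-- mandated namespace `Summit.HodgeConjecture.HodgeConjecture.…` (Problem = Summit) trips `linter.dupNamespace`; the lakefile disables it
-- tree-wide (weak option), restated here so stand-alone elaboration is warning-free too.
set_option linter.dupNamespace false

namespace Summit.HodgeConjecture.HodgeConjecture.WeilTypeLadder

open Literature.AlgebraicGeometry.Modules Literature.AlgebraicGeometry.Motives
open Literature.AlgebraicGeometry.HodgeTheory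
open Summit.Ventures.HSemireg

section SheafVia

universe w₁ u₁

variable {S : Type u₁} [CommRing S] (X : Over (Spec (CommRingCat.of S)))
  [HasDerivedCategory.{w₁} X.left.Modules] {E₀ : X.left.Modules}

/-- **`I`-semiregularity of an `𝒪_X`-module `E₀` computed on a strictly perfect resolution `R`** (a DEFINITION, nothing asserted):
`(σ_q)_{q ∈ I}` of the strictly perfect complex `R.P ≃ E₀` is jointly injective on `Ext²(R.P, R.P) ≅ Ext²(E₀, E₀)` — HSemireg's
`HomComplex.IsISemiregularC` of the resolving complex in the window `[-R.length, 0]`; BF's "`ℰ₀` is `I`-semiregular" read in `D^b(X)`,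
independent of `R` by `isISemiregularSheafVia_iff_of_roof`. [cite: BuchweitzFlenner2003, Def. 4.1 and §5 (I-semiregular)] -/
def IsISemiregularSheafVia (R : StrictlyPerfectResolution E₀) (I : Set ℕ) : Prop :=
  HomComplex.IsISemiregularC X R.P (-(R.length : ℤ)) 0 R.isFiniteLocallyFree I

/-- Any amplitude window `[a, b]` containing the support of the resolving complex computes
`IsISemiregularSheafVia` (window independence of HSemireg's `σ_q`). [cite: BuchweitzFlenner2003, §5 (I-semiregular)] -/
theorem isISemiregularSheafVia_iff_of_window (R : StrictlyPerfectResolution E₀) (a b : ℤ)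
    [R.P.IsStrictlyGE a] [R.P.IsStrictlyLE b] (I : Set ℕ) :
    IsISemiregularSheafVia X R I ↔ HomComplex.IsISemiregularC X R.P a b R.isFiniteLocallyFree I :=
  HomComplex.isISemiregularC_iff_of_window' X R.P a b (-(R.length : ℤ)) 0 R.isFiniteLocallyFree I

/-- `I`-semiregularity via a resolution is monotone in `I`. [cite: BuchweitzFlenner2003, §5 (I-semiregular)] -/
theorem IsISemiregularSheafVia.mono {R : StrictlyPerfectResolution E₀} {I J : Set ℕ} (hIJ : I ⊆ J)
    (h : IsISemiregularSheafVia X R I) : IsISemiregularSheafVia X R J :=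
  HomComplex.IsISemiregularC.mono X R.P hIJ h

omit [HasDerivedCategory.{w₁} X.left.Modules] in
/-- A morphism of strictly perfect resolutions OVER `E₀` (`f ≫ ε₂ = ε₁`) is a quasi-isomorphism
(two-out-of-three). [folklore] -/
theorem quasiIso_of_hom_over (R₁ R₂ : StrictlyPerfectResolution E₀) (f : R₁.P ⟶ R₂.P)
    (hf : f ≫ R₂.ε = R₁.ε) : QuasiIso f := by
  haveI : QuasiIso (f ≫ R₂.ε) := hf ▸ R₁.quasiIso
  exact quasiIso_of_comp_right f R₂.ε

/-- **Independence of the resolution, along a morphism over `E₀`** (`f ≫ ε₂ = ε₁`; `f` is a quasi-isomorphism; HSemireg's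
`isISemiregularC_iff_of_quasiIso` in a common window). [cite: BuchweitzFlenner2003, §5 (I-semiregular)] -/
theorem isISemiregularSheafVia_iff_of_hom (R₁ R₂ : StrictlyPerfectResolution E₀) (f : R₁.P ⟶ R₂.P)
    (hf : f ≫ R₂.ε = R₁.ε) (I : Set ℕ) :
    IsISemiregularSheafVia X R₁ I ↔ IsISemiregularSheafVia X R₂ I := by
  haveI : QuasiIso f := quasiIso_of_hom_over X R₁ R₂ f hf
  -- common window `[m, 0]`, `m = min (-len₁) (-len₂)`
  haveI := R₁.P.isStrictlyGE_of_ge (min (-(R₁.length : ℤ)) (-(R₂.length : ℤ))) _ (min_le_left _ _)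
  haveI := R₂.P.isStrictlyGE_of_ge (min (-(R₁.length : ℤ)) (-(R₂.length : ℤ))) _ (min_le_right _ _)
  rw [isISemiregularSheafVia_iff_of_window X R₁ (min (-(R₁.length : ℤ)) (-(R₂.length : ℤ))) 0 I,
    isISemiregularSheafVia_iff_of_window X R₂ (min (-(R₁.length : ℤ)) (-(R₂.length : ℤ))) 0 I]
  exact HomComplex.isISemiregularC_iff_of_quasiIso X _ 0 R₁.isFiniteLocallyFree R₂.isFiniteLocallyFree f I

/-- **Independence of the resolution, along a roof** `R₁ ← R₃ → R₂` over `E₀` (the shape in which any two resolutions are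
compared). [cite: BuchweitzFlenner2003, §5 (I-semiregular)] -/
theorem isISemiregularSheafVia_iff_of_roof (R₁ R₂ R₃ : StrictlyPerfectResolution E₀) (g₁ : R₃.P ⟶ R₁.P)
    (g₂ : R₃.P ⟶ R₂.P) (hg₁ : g₁ ≫ R₁.ε = R₃.ε) (hg₂ : g₂ ≫ R₂.ε = R₃.ε) (I : Set ℕ) :
    IsISemiregularSheafVia X R₁ I ↔ IsISemiregularSheafVia X R₂ I :=
  (isISemiregularSheafVia_iff_of_hom X R₃ R₁ g₁ hg₁ I).symm.trans
    (isISemiregularSheafVia_iff_of_hom X R₃ R₂ g₂ hg₂ I)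

/-- **Faithfulness on vector bundles**: via the trivial resolution `E₀[0]` the predicate IS the tree's module-level
`IsISemiregular hE₀ I` (HSemireg's column anchor `isISemiregularC_single₀_iff`). [cite: BuchweitzFlenner2003, §5 (I-semiregular)] -/
theorem isISemiregularSheafVia_ofFiniteLocallyFree_iff (hE₀ : IsFiniteLocallyFree E₀) (I : Set ℕ) :
    IsISemiregularSheafVia X (StrictlyPerfectResolution.ofFiniteLocallyFree hE₀) I ↔
      IsISemiregular hE₀ I := by
  rw [isISemiregularSheafVia_iff_of_window X (StrictlyPerfectResolution.ofFiniteLocallyFree hE₀) 0 0 I]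
  exact HomComplex.isISemiregularC_single₀_iff X E₀ hE₀ _ I

/-- Hence for EVERY strictly perfect resolution `R` of a finite locally free `E₀` (compare with `E₀[0]` along `f := R.ε`),
`I`-semiregularity via `R` is `IsISemiregular hE₀ I`. [cite: BuchweitzFlenner2003, §5 (I-semiregular)] -/
theorem isISemiregularSheafVia_iff_isISemiregular (hE₀ : IsFiniteLocallyFree E₀)
    (R : StrictlyPerfectResolution E₀) (I : Set ℕ) :
    IsISemiregularSheafVia X R I ↔ IsISemiregular hE₀ I := by
  rw [← isISemiregularSheafVia_ofFiniteLocallyFree_iff X hE₀ I]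
  exact isISemiregularSheafVia_iff_of_hom X R (StrictlyPerfectResolution.ofFiniteLocallyFree hE₀) R.ε
    (Category.comp_id _) I

/-- **`I`-semiregularity of an `𝒪_X`-module as an object of `D^b(X)`** (a DEFINITION, nothing asserted): `E₀` admits a strictly
perfect resolution on which `(σ_q)_{q ∈ I}` is jointly injective (resolution immaterial by `…_iff_of_roof`; FALSE, not vacuously true,
without a resolution) — the hypothesis "`ℰ₀` is `I`-semiregular" of BF Thm. 5.1. [cite: BuchweitzFlenner2003, §5 (I-semiregular)] -/
def IsISemiregularSheaf (E₀ : X.left.Modules) (I : Set ℕ) : Prop :=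
  ∃ R : StrictlyPerfectResolution E₀, IsISemiregularSheafVia X R I

/-- A finite locally free `E₀` is `I`-semiregular as a sheaf iff it is `I`-semiregular in the tree's
module-level sense. [cite: BuchweitzFlenner2003, §5 (I-semiregular)] -/
theorem isISemiregularSheaf_iff_isISemiregular (hE₀ : IsFiniteLocallyFree E₀) (I : Set ℕ) :
    IsISemiregularSheaf X E₀ I ↔ IsISemiregular hE₀ I :=
  ⟨fun ⟨R, hR⟩ => (isISemiregularSheafVia_iff_isISemiregular X hE₀ R I).1 hR,
    fun h => ⟨StrictlyPerfectResolution.ofFiniteLocallyFree hE₀,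
      (isISemiregularSheafVia_ofFiniteLocallyFree_iff X hE₀ I).2 h⟩⟩

/-- `I`-semiregularity as a sheaf is monotone in `I`. [cite: BuchweitzFlenner2003, §5 (I-semiregular)] -/
theorem IsISemiregularSheaf.mono {E₀ : X.left.Modules} {I J : Set ℕ} (hIJ : I ⊆ J)
    (h : IsISemiregularSheaf X E₀ I) : IsISemiregularSheaf X E₀ J := by
  obtain ⟨R, hR⟩ := h
  exact ⟨R, hR.mono X hIJ⟩

end SheafVia

/-! ### The value of `σ_q` on the module-level `Ext²(E₀, E₀)` and the kernel form of the predicate -/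

section Value

universe w₁ u₁

open DerivedCategory

variable {S : Type u₁} [CommRing S] (X : Over (Spec (CommRingCat.of S)))
  [HasDerivedCategory.{w₁} X.left.Modules] {E₀ : X.left.Modules}

/-- `x.hom : E₀[0] ⟶ E₀[0]⟦2⟧` (Mathlib `Abelian.Ext.hom`) re-typed at the literal shift `(2 : ℤ)` of HSemireg's `sigmaC`. [folklore] -/
def homTwo (x : Abelian.Ext E₀ E₀ 2) :
    ShiftedHom ((DerivedCategory.singleFunctor X.left.Modules 0).obj E₀)
      ((DerivedCategory.singleFunctor X.left.Modules 0).obj E₀) (2 : ℤ) :=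
  x.hom

/-- The inverse re-typing (Mathlib `Abelian.Ext.homEquiv.symm`). [folklore] -/
def ofHomTwo (y : ShiftedHom ((DerivedCategory.singleFunctor X.left.Modules 0).obj E₀)
    ((DerivedCategory.singleFunctor X.left.Modules 0).obj E₀) (2 : ℤ)) : Abelian.Ext E₀ E₀ 2 :=
  Abelian.Ext.homEquiv.symm y

/-- `homTwo` is injective (Mathlib `Abelian.Ext.homEquiv`). [folklore] -/
theorem homTwo_injective : Function.Injective (homTwo X (E₀ := E₀)) :=
  fun _ _ h => Abelian.Ext.homEquiv.injective h

/-- `homTwo ∘ ofHomTwo = id`. [folklore] -/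
@[simp]
theorem homTwo_ofHomTwo (y : ShiftedHom ((DerivedCategory.singleFunctor X.left.Modules 0).obj E₀)
    ((DerivedCategory.singleFunctor X.left.Modules 0).obj E₀) (2 : ℤ)) : homTwo X (ofHomTwo X y) = y :=
  Abelian.Ext.homEquiv.apply_symm_apply y

/-- `homTwo 0 = 0`. [folklore] -/
@[simp]
theorem homTwo_zero : homTwo X (0 : Abelian.Ext E₀ E₀ 2) = 0 :=
  Abelian.Ext.zero_hom _ _ _

variable (R : StrictlyPerfectResolution E₀)

/-- `Q ε : Q P• ⟶ E₀[0]` in `D(X)`, target typed `(DerivedCategory.singleFunctor _ 0).obj E₀` (`singleFunctorIsoCompQ = Iso.refl`).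
[folklore] -/
def Qε : Q.obj R.P ⟶ (DerivedCategory.singleFunctor X.left.Modules 0).obj E₀ :=
  Q.map R.ε

/-- `Q ε` is an isomorphism of `D(X)` (Mathlib `isIso_Q_map_iff_quasiIso`). [folklore] -/
instance isIso_Qε : IsIso (Qε X R) :=
  (isIso_Q_map_iff_quasiIso (φ := R.ε)).2 inferInstance

/-- A class `x ∈ Ext²(E₀, E₀)` READ ON THE RESOLVING COMPLEX: conjugation of `x.hom` by the isomorphism `Q ε` — the identification
`Ext²(E₀, E₀) = Ext²(P•, P•)` through which BF evaluate `σ` on a resolution. [cite: BuchweitzFlenner2003, Def. 4.1] -/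
def extTwoOnResolution (x : Abelian.Ext E₀ E₀ 2) : ShiftedHom (Q.obj R.P) (Q.obj R.P) (2 : ℤ) :=
  Qε X R ≫ homTwo X x ≫ (inv (Qε X R))⟦(2 : ℤ)⟧'

/-- The inverse reading: a degree-`2` endomorphism class of `Q P•` as a class in `Ext²(E₀, E₀)`.
[cite: BuchweitzFlenner2003, Def. 4.1] -/
def extTwoOfResolution (y : ShiftedHom (Q.obj R.P) (Q.obj R.P) (2 : ℤ)) : Abelian.Ext E₀ E₀ 2 :=
  ofHomTwo X (inv (Qε X R) ≫ y ≫ (Qε X R)⟦(2 : ℤ)⟧')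

/-- `extTwoOfResolution` is a left inverse of `extTwoOnResolution`. [folklore] -/
theorem extTwoOfResolution_extTwoOnResolution (x : Abelian.Ext E₀ E₀ 2) :
    extTwoOfResolution X R (extTwoOnResolution X R x) = x := by
  apply homTwo_injective X
  rw [extTwoOfResolution, homTwo_ofHomTwo, extTwoOnResolution]
  simp only [Category.assoc, IsIso.inv_hom_id_assoc, ← Functor.map_comp, IsIso.inv_hom_id,
    CategoryTheory.Functor.map_id, Category.comp_id]

/-- `extTwoOfResolution` is a right inverse of `extTwoOnResolution`. [folklore] -/
theorem extTwoOnResolution_extTwoOfResolution (y : ShiftedHom (Q.obj R.P) (Q.obj R.P) (2 : ℤ)) :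
    extTwoOnResolution X R (extTwoOfResolution X R y) = y := by
  rw [extTwoOnResolution, extTwoOfResolution, homTwo_ofHomTwo]
  simp only [Category.assoc, IsIso.hom_inv_id_assoc, ← Functor.map_comp, IsIso.hom_inv_id,
    CategoryTheory.Functor.map_id, Category.comp_id]

/-- Reading `Ext²(E₀, E₀)` on the resolving complex is a bijection onto `Ext²(P•, P•)`.
[cite: BuchweitzFlenner2003, Def. 4.1] -/
theorem extTwoOnResolution_bijective : Function.Bijective (extTwoOnResolution X R) :=
  Function.bijective_iff_has_inverse.2
    ⟨extTwoOfResolution X R, extTwoOfResolution_extTwoOnResolution X R,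
      extTwoOnResolution_extTwoOfResolution X R⟩

/-- The zero class reads as zero. [folklore] -/
@[simp]
theorem extTwoOnResolution_zero : extTwoOnResolution X R 0 = 0 := by
  rw [extTwoOnResolution, homTwo_zero, zero_comp, comp_zero]

/-- A class reads as zero on the resolution iff it is zero. [folklore] -/
theorem extTwoOnResolution_eq_zero_iff (x : Abelian.Ext E₀ E₀ 2) :
    extTwoOnResolution X R x = 0 ↔ x = 0 := by
  refine ⟨fun h => ?_, fun h => h ▸ extTwoOnResolution_zero X R⟩
  rw [← extTwoOfResolution_extTwoOnResolution X R x, h, ← extTwoOnResolution_zero X R,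
    extTwoOfResolution_extTwoOnResolution]

/-- **`σ_q : Ext²(E₀, E₀) → H^{q+2}(X, Ω^q)` of an `𝒪_X`-module computed on a strictly perfect resolution `R`**: HSemireg's
`sigmaCoh` of the resolving complex at the class read on it (no `(-1)^q/q!`). [cite: BuchweitzFlenner2003, Def. 4.1] -/
def sigmaSheafVia (q : ℕ) (x : Abelian.Ext E₀ E₀ 2) : hodgeCohomology X q (q + 2) :=
  HomComplex.sigmaCoh X R.P (-(R.length : ℤ)) 0 R.isFiniteLocallyFree q (extTwoOnResolution X R x)

/-- `σ_q(0) = 0`. [cite: BuchweitzFlenner2003, Def. 4.1] -/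
@[simp]
theorem sigmaSheafVia_zero (q : ℕ) : sigmaSheafVia X R q 0 = 0 := by
  have h0 : HomComplex.sigmaExt X R.P (-(R.length : ℤ)) 0 R.isFiniteLocallyFree q 0 = 0 := by
    rw [HomComplex.sigmaExt, HomComplex.sigmaC_zero, Equiv.symm_apply_eq]
    exact (Abelian.Ext.zero_hom _ _ _).symm
  rw [sigmaSheafVia, extTwoOnResolution_zero, HomComplex.sigmaCoh, h0, map_zero]
  rfl

/-- **Kernel form** (the shape of the tree's `IsISemiregular`): `I`-semiregular via `R` iff every `x ∈ Ext²(E₀, E₀)` with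
`σ_q(x) = 0` for all `q ∈ I` is zero. [cite: BuchweitzFlenner2003, §5 (I-semiregular)] -/
theorem isISemiregularSheafVia_iff_ker (I : Set ℕ) :
    IsISemiregularSheafVia X R I ↔
      ∀ x : Abelian.Ext E₀ E₀ 2, (∀ q ∈ I, sigmaSheafVia X R q x = 0) → x = 0 := by
  rw [IsISemiregularSheafVia, HomComplex.isISemiregularC_iff_coh']
  constructor
  · intro h x hx
    exact (extTwoOnResolution_eq_zero_iff X R x).1 (h _ hx)
  · intro h y hy
    obtain ⟨x, rfl⟩ := (extTwoOnResolution_bijective X R).2 y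
    rw [h x hy, extTwoOnResolution_zero]

end Value

end Summit.HodgeConjecture.HodgeConjecture.WeilTypeLadder

end
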